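import Summits.QuantumFields.YangMills.Theorems.UnitScaleTiltProp7Lane2PatchCommutatorRows
import HarnessLib

/-!
# Route `UnitScaleTilt`, crux «MinimiserStabilityRegPr» (stmt-QuantumFields-19200), E′ ∕ (N06) LANE II — brick (B6), THE CUTOFF OPERATORS OF ONE REAL WEIGHT, EXPORTED:
# for ANY `ζ : Site → ℝ` there are ℂ-linear `Zs : SiteL2K →ₗ SiteL2K`, `Zb : BondL2K →ₗ BondL2K` with the (Z2) readings

Cell `ym3-torus`, width seat `ym3-torus-px11` (gen 7); ★p1 g19 NAMER WORD №16 (b) «χ-PACKAGE: hat + `(Zχs, Zχb)` (Z2) readings (px11's 10-line construction)» — that construction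
sits `let`-bound INSIDE the proof of ✓`Prop7Lane2CutoffPackage.exists_cutoffPackage` (a family indexed by centres); here it is exported ONCE for a single arbitrary real weight, so the
χ-package (w1 g16), the ζ̃-operators of RECIPE v1 traps 1–2, or any other scalar cutoff obtains its operator pair by ONE `obtain`, and every row of ✓p718327∕✓p718470∕✓p719466
((B6-LOC), stated for «any linear `Z`, `ZE` with the (Z2) readings of one real `ζ`») and of ✓`Prop7DivRecoveryCutoffReadings` (`siteCutoff_congr`, `norm_sq_siteCutoff_le`, `patch_hDφ`, …)
applies to it verbatim.  THEOREMS ONLY (0 `def`, 0 `sorry`); `--supports stmt-QuantumFields-19200`, count-neutral.  YM₃ on T³ is a ladder rung (R3), not the Clay problem; nothing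
here claims (B7), (REC), `hN06`, a stub, the crux, d = 4 or the mass gap.

WHAT IS PROVED (ns `…Theorems.Prop7Lane2CutoffOps`): ★★ `exists_cutoffOps (ζ)` — the operator pair with the two readings; ★ `exists_cutoffOps_norm_le (ζ) (h01 : 0 ≤ ζ ≤ 1)` — the
same pair together with the contractions `‖Zs φ‖ ^ 2 ≤ ‖φ‖ ^ 2`, `‖Zb f‖ ^ 2 ≤ ‖f‖ ^ 2` (the consumer may equally cite ✓`Prop7DivRecoveryCutoffReadings.norm_sq_siteCutoff_le_norm_sq`∕`…bondCutoff…`;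
proved here from the readings and ✓`Prop7CovAgmonLetters.hs_smul` to keep this file on the (B6) import line).
HONEST SCOPE.  Linear-algebra packaging; nothing of `hPatch`∕(B7)∕(REC)∕hN06∕the crux is proved or claimed.

References: T. Bałaban, CMP 99 (1985) 389–434 [Balaban1985BackgroundPropagators] ((3.19) p.393, (3.100) pp.413–414).
-/

set_option autoImplicit false

noncomputable section

open scoped BigOperators Matrix.Norms.L2Operator Matrix

namespace Summit.QuantumFields.YangMills.Theorems.Prop7Lane2CutoffOps

open Literature.MathematicalPhysics.QuantumFieldTheory.Balaban1983to89
open Literature.MathematicalPhysics.QuantumFieldTheory.Balaban1983to89.T3ContinuumYM3Torus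
open B11Eq103H1Complex (SiteL2K BondL2K)
open Summit.QuantumFields.YangMills.Theorems.Prop7SectET3Transport (periodsT3)
open Summit.QuantumFields.YangMills.Theorems.Prop7SectET3HilbertLetters (W₂ toL2 toL2S)
open Summit.QuantumFields.YangMills.Theorems.Prop7LaplaceAFlatLetters (norm_sq_toL2 norm_sq_toL2S)
open Summit.QuantumFields.YangMills.Theorems.Prop7CovAgmonLetters (hs_smul)

variable (F : T3Family) (K : ℕ) (c₀ : ℝ) [Fact (0 < c₀)]

omit [Fact (0 < c₀)] in
/-- ★★ **THE CUTOFF OPERATORS OF ONE REAL WEIGHT**: for every `ζ : Site → ℝ` there are ℂ-linear maps `Zs` on the member's site space and `Zb` on its bond space READING as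
multiplication by `ζ` (sites) and by `ζ(b₋)` (bonds): `toL2S⁻¹(Zs φ) x = ζ x • toL2S⁻¹φ x`, `toL2⁻¹(Zb f) b = ζ b.src • toL2⁻¹f b` — the (Z2) rows of ✓`exists_cutoffPackage`
for a single weight. [cite: Balaban1985BackgroundPropagators, (3.19) p.393, (3.100) pp.413–414] -/
theorem exists_cutoffOps (ζ : Site (F.P K) 0 → ℝ) :
    ∃ (Zs : SiteL2K ℂ 3 (periodsT3 F K) c₀ W₂ →ₗ[ℂ] SiteL2K ℂ 3 (periodsT3 F K) c₀ W₂)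
      (Zb : BondL2K ℂ 3 (periodsT3 F K) c₀ W₂ →ₗ[ℂ] BondL2K ℂ 3 (periodsT3 F K) c₀ W₂),
      (∀ φ x, (toL2S F K c₀).symm (Zs φ) x = ζ x • (toL2S F K c₀).symm φ x) ∧
      (∀ f b, (toL2 F K c₀).symm (Zb f) b = ζ b.src • (toL2 F K c₀).symm f b) := by
  -- multiplication by the real weight on the function side, conjugated by the Riesz identifications
  let mS : (Site (F.P K) 0 → Matrix (Fin 2) (Fin 2) ℂ) →ₗ[ℂ] (Site (F.P K) 0 → Matrix (Fin 2) (Fin 2) ℂ) :=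
    { toFun := fun g x => ((ζ x : ℝ) : ℂ) • g x
      map_add' := fun g g' => by funext x; simp only [Pi.add_apply, smul_add]
      map_smul' := fun r g => by funext x; simp only [Pi.smul_apply, RingHom.id_apply, smul_comm r] }
  let mB : (PBond (F.P K) 0 → Matrix (Fin 2) (Fin 2) ℂ) →ₗ[ℂ] (PBond (F.P K) 0 → Matrix (Fin 2) (Fin 2) ℂ) :=
    { toFun := fun g b => ((ζ b.src : ℝ) : ℂ) • g b
      map_add' := fun g g' => by funext b; simp only [Pi.add_apply, smul_add]
      map_smul' := fun r g => by funext b; simp only [Pi.smul_apply, RingHom.id_apply, smul_comm r] }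
  refine ⟨(toL2S F K c₀).toLinearMap ∘ₗ mS ∘ₗ (toL2S F K c₀).symm.toLinearMap, (toL2 F K c₀).toLinearMap ∘ₗ mB ∘ₗ (toL2 F K c₀).symm.toLinearMap,
    fun φ x => ?_, fun f b => ?_⟩
  · show (toL2S F K c₀).symm (toL2S F K c₀ (mS ((toL2S F K c₀).symm φ))) x = _
    rw [LinearEquiv.symm_apply_apply]
    exact Complex.coe_smul _ _
  · show (toL2 F K c₀).symm (toL2 F K c₀ (mB ((toL2 F K c₀).symm f))) b = _
    rw [LinearEquiv.symm_apply_apply]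
    exact Complex.coe_smul _ _

/-- ★ **THE SAME PAIR WITH THE CONTRACTIONS** for weights in `[0,1]`: `‖Zs φ‖² ≤ ‖φ‖²`, `‖Zb f‖² ≤ ‖f‖²`. [cite: Balaban1985BackgroundPropagators, (3.19) p.393, (3.11) p.392] -/
theorem exists_cutoffOps_norm_le (ζ : Site (F.P K) 0 → ℝ) (h01 : ∀ x, 0 ≤ ζ x ∧ ζ x ≤ 1) :
    ∃ (Zs : SiteL2K ℂ 3 (periodsT3 F K) c₀ W₂ →ₗ[ℂ] SiteL2K ℂ 3 (periodsT3 F K) c₀ W₂)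
      (Zb : BondL2K ℂ 3 (periodsT3 F K) c₀ W₂ →ₗ[ℂ] BondL2K ℂ 3 (periodsT3 F K) c₀ W₂),
      (∀ φ x, (toL2S F K c₀).symm (Zs φ) x = ζ x • (toL2S F K c₀).symm φ x) ∧
      (∀ f b, (toL2 F K c₀).symm (Zb f) b = ζ b.src • (toL2 F K c₀).symm f b) ∧
      (∀ φ, ‖Zs φ‖ ^ 2 ≤ ‖φ‖ ^ 2) ∧ (∀ f, ‖Zb f‖ ^ 2 ≤ ‖f‖ ^ 2) := by
  obtain ⟨Zs, Zb, hZs, hZb⟩ := exists_cutoffOps F K c₀ ζ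
  have hc : (0 : ℝ) < c₀ := Fact.out
  -- `hs(t • M) = t²·hs(M) ≤ hs(M)` for `t ∈ [0,1]`
  have hsle : ∀ (t : ℝ), 0 ≤ t ∧ t ≤ 1 → ∀ M : Matrix (Fin 2) (Fin 2) ℂ,
      ∑ j : Fin 2, ∑ k : Fin 2, ‖(t • M) j k‖ ^ 2 ≤ ∑ j : Fin 2, ∑ k : Fin 2, ‖M j k‖ ^ 2 := by
    intro t ht M
    rw [hs_smul]
    have h1 : t ^ 2 ≤ 1 := pow_le_one₀ ht.1 ht.2
    have h0 : 0 ≤ ∑ j : Fin 2, ∑ k : Fin 2, ‖M j k‖ ^ 2 := Finset.sum_nonneg fun _ _ => Finset.sum_nonneg fun _ _ => sq_nonneg _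
    nlinarith
  refine ⟨Zs, Zb, hZs, hZb, fun φ => ?_, fun f => ?_⟩
  · have e1 : Zs φ = toL2S F K c₀ (fun x => ζ x • (toL2S F K c₀).symm φ x) := by
      apply (toL2S F K c₀).symm.injective
      rw [LinearEquiv.symm_apply_apply]; funext x; exact hZs φ x
    have e2 : φ = toL2S F K c₀ ((toL2S F K c₀).symm φ) := (LinearEquiv.apply_symm_apply _ _).symm
    rw [e1, norm_sq_toL2S]
    conv_rhs => rw [e2, norm_sq_toL2S]
    exact mul_le_mul_of_nonneg_left (Finset.sum_le_sum fun x _ => hsle _ (h01 x) _) hc.le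
  · have e1 : Zb f = toL2 F K c₀ (fun b => ζ b.src • (toL2 F K c₀).symm f b) := by
      apply (toL2 F K c₀).symm.injective
      rw [LinearEquiv.symm_apply_apply]; funext b; exact hZb f b
    have e2 : f = toL2 F K c₀ ((toL2 F K c₀).symm f) := (LinearEquiv.apply_symm_apply _ _).symm
    rw [e1, norm_sq_toL2]
    conv_rhs => rw [e2, norm_sq_toL2]
    exact mul_le_mul_of_nonneg_left (Finset.sum_le_sum fun b _ => hsle _ (h01 b.src) _) hc.le

end Summit.QuantumFields.YangMills.Theorems.Prop7Lane2CutoffOps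

end
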